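import Mathlib
import Literature.RingTheory.MvPowerSeries.MaximalIdealPow
import Literature.AlgebraicGeometry.Resolution.CompleteFiniteness
import Literature.RingTheory.KrullDimension.AffineDimension
import Summits.ResolutionOfSingularities.ResolutionOfSingularities.Theorems.WeightedInvariantLocalWeightedDropTOT2BranchValuation
import Summits.ResolutionOfSingularities.ResolutionOfSingularities.Theorems.HilbertSamuelEliminationSigmaMaxModificationsCorridor3CPFrameCurveGermAlgebra

/-!
# TOT2-LINE (P3) brick B3, part 1/2: BIRATIONAL INJECTIONS HAVE THE SAME NORMALISATION; the quotient map along a chart endomorphism of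
# `k⟦u₁,u₂,y⟧` is injective, finite and birational

Sub-problem `ResolutionOfSingularities`, ENGINE crux `stmt-ResolutionOfSingularities-8899` (`LocalWeightedDrop`), skeleton v35
(2e806da509994632), registered stub `stub_conflictBudget` (P3); brick B3 «chart invariance of the canonical branch valuation» of
`L/res-L1-w43-stub-2/g6/CONFLICT-BUDGET-DESIGN-v1.md` §6 (owner res-L1-w43-stub-2 g6; this hand res-L1-w43-stub-1 g7).
[OURS · L1 W4.3 · chain w43.  Engine bookkeeping: nothing here is a statement of any manuscript; AI-produced, gate-checked, weaker than expert
review.  «[OURS · L1 W4.3] replaces the role of nothing printed; NOT a statement of the manuscript.»]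

§1 (abstract).  For an injective ring homomorphism `φ : D → D′` of domains which is BIRATIONAL (every element of `D′` is a quotient
`φ a / φ b`) the induced map of fraction fields is an isomorphism; if moreover `D′` is integral over `D` it restricts to an isomorphism
`W ≃ W′` of the integral closures (`exists_integralClosure_ringEquiv_of_birational`), so `W` is a discrete valuation ring when `W′` is and
the additive valuations agree on `D` (`addVal_integralClosure_eq_of_birational`; DVR transport along `≃+*` is the tree's
`SigmaMaxModificationsCorridor3.Helpers.isDiscreteValuationRing_of_ringEquiv`).  Ring isomorphisms `D ≃ D′` are the special case
`exists_integralClosure_ringEquiv_of_ringEquiv`.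

§2 (power series; hypotheses of the owner's split v1 `branchVal_comap_eq`).  For a `k`-algebra endomorphism `c` of `R₃ = k⟦X₀,X₁,X₂⟧` and a
prime `P′` with `𝔪^N ⊆ P′ + c(𝔪)R₃` (`hprim`; automatic when `dim R₃ ⧸ P′ = 1` and some `u ∈ 𝔪` has `c u ∉ P′`:
`exists_maximalIdeal_pow_le_sup_map`) and every variable a fraction `c g / c t` modulo `P′` (`hbir`), the map `R₃ ⧸ comap c P′ ↪ R₃ ⧸ P′` is
injective, module-finite (complete Nakayama, Matsumura 8.4, over the jets) and birational (`quotientMap_finite_birational`); hence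
`dim R₃ ⧸ comap c P′ = dim R₃ ⧸ P′ = 1` (`ringKrullDim_quotient_comap_eq_one`, Matsumura 9.4).  Part 2/2 (`…TOT2BranchChartInvariance`) reads
this through `TOT2Branch.branchVal`.
-/

set_option linter.dupNamespace false -- mandated namespace of this single-conjunct summit

noncomputable section

namespace Summit.ResolutionOfSingularities.ResolutionOfSingularities.Theorems

namespace TOT2Branch

open MvPowerSeries IsLocalRing

/-! ## §1 Birational injections of domains: same fraction field, same normalisation, same valuation -/

section Abstract

variable {D D' : Type*} [CommRing D] [IsDomain D] [CommRing D'] [IsDomain D']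

omit [IsDomain D] [IsDomain D'] in
/-- `D → D′ → Frac D′` is injective for an injective `φ`. -/
theorem injective_algebraMap_comp (φ : D →+* D') (hφ : Function.Injective φ) :
    Function.Injective ((algebraMap D' (FractionRing D')).comp φ) :=
  (IsFractionRing.injective D' (FractionRing D')).comp hφ

/-- **Birational ⇒ the lift `Frac D → Frac D′` is onto.** -/
theorem lift_surjective_of_birational (φ : D →+* D') (hφ : Function.Injective φ)
    (hbir : ∀ x : D', ∃ a b : D, b ≠ 0 ∧ φ b * x = φ a) :
    Function.Surjective (IsFractionRing.lift (K := FractionRing D) (injective_algebraMap_comp φ hφ)) := by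
  intro z
  obtain ⟨x, y, hy, rfl⟩ := IsFractionRing.div_surjective (A := D') z
  obtain ⟨a, b, hb, hab⟩ := hbir x
  obtain ⟨a', b', hb', hab'⟩ := hbir y
  have hinjK := IsFractionRing.injective D' (FractionRing D')
  have hφb : algebraMap D' (FractionRing D') (φ b) ≠ 0 := fun h => hb (hφ (by
    have := hinjK (h.trans (map_zero _).symm); rw [this, map_zero]))
  have hφb' : algebraMap D' (FractionRing D') (φ b') ≠ 0 := fun h => hb' (hφ (by
    have := hinjK (h.trans (map_zero _).symm); rw [this, map_zero]))
  have hx : algebraMap D' (FractionRing D') x = algebraMap _ _ (φ a) / algebraMap _ _ (φ b) := by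
    rw [eq_div_iff hφb, mul_comm, ← map_mul, hab]
  have hy' : algebraMap D' (FractionRing D') y = algebraMap _ _ (φ a') / algebraMap _ _ (φ b') := by
    rw [eq_div_iff hφb', mul_comm, ← map_mul, hab']
  refine ⟨algebraMap D _ (a * b') / algebraMap D _ (b * a'), ?_⟩
  rw [map_div₀, IsFractionRing.lift_algebraMap, IsFractionRing.lift_algebraMap, hx, hy']
  simp only [RingHom.comp_apply, map_mul]
  rw [div_div_div_eq]

/-- **SAME NORMALISATION.**  For an injective birational `φ : D → D′` with `D′` integral over `D`, the fraction-field isomorphism restricts to a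
ring isomorphism of the integral closures compatible with `φ`. -/
theorem exists_integralClosure_ringEquiv_of_birational (φ : D →+* D') (hφ : Function.Injective φ)
    (hbir : ∀ x : D', ∃ a b : D, b ≠ 0 ∧ φ b * x = φ a) (hint : φ.IsIntegral) :
    ∃ e : integralClosure D (FractionRing D) ≃+* integralClosure D' (FractionRing D'),
      ∀ a : D, e (algebraMap D _ a) = algebraMap D' _ (φ a) := by
  classical
  have hg := injective_algebraMap_comp φ hφ
  set ψ₀ : FractionRing D →+* FractionRing D' := IsFractionRing.lift (K := FractionRing D) hg with hψ₀
  have hψalg : ∀ a, ψ₀ (algebraMap D (FractionRing D) a) = algebraMap D' (FractionRing D') (φ a) := fun a =>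
    IsFractionRing.lift_algebraMap hg a
  have hcomp : ψ₀.comp (algebraMap D (FractionRing D)) = (algebraMap D' (FractionRing D')).comp φ :=
    RingHom.ext fun a => hψalg a
  have hsurj : Function.Surjective ψ₀ := lift_surjective_of_birational φ hφ hbir
  let ψ : FractionRing D ≃+* FractionRing D' := RingEquiv.ofBijective ψ₀ ⟨ψ₀.injective, hsurj⟩
  have hψ : ∀ w, ψ w = ψ₀ w := fun _ => rfl
  -- forward integrality
  have hfwd : ∀ w : FractionRing D, IsIntegral D w → IsIntegral D' (ψ₀ w) := by
    rintro w ⟨p, hp, hpw⟩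
    refine ⟨p.map φ, hp.map φ, ?_⟩
    rw [Polynomial.eval₂_map, ← hcomp, ← Polynomial.hom_eval₂, hpw, map_zero]
  -- backward integrality (transitivity through `D′`, which is integral over `D`)
  have hbwd : ∀ w' : FractionRing D', IsIntegral D' w' → IsIntegral D (ψ.symm w') := by
    intro w' hw'
    letI : Algebra D D' := φ.toAlgebra
    haveI : Algebra.IsIntegral D D' := ⟨hint⟩
    have hK' : algebraMap D (FractionRing D') = (algebraMap D' (FractionRing D')).comp φ :=
      IsScalarTower.algebraMap_eq D D' (FractionRing D')
    obtain ⟨p, hp, hpw⟩ := isIntegral_trans (R := D) w' hw'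
    refine ⟨p, hp, ψ.injective ?_⟩
    rw [map_zero, hψ, Polynomial.hom_eval₂, hcomp, ← hK', ← hψ, RingEquiv.apply_symm_apply]
    exact hpw
  -- the restriction
  have hmem : ∀ w : integralClosure D (FractionRing D),
      (ψ₀.comp (algebraMap (integralClosure D (FractionRing D)) (FractionRing D))) w ∈ integralClosure D' (FractionRing D') :=
    fun w => hfwd w w.2
  let θ₀ : integralClosure D (FractionRing D) →+* integralClosure D' (FractionRing D') :=
    (ψ₀.comp (algebraMap (integralClosure D (FractionRing D)) (FractionRing D))).codRestrict _ hmem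
  have hθ₀ : ∀ w, (θ₀ w : FractionRing D') = ψ₀ w := fun _ => rfl
  have hθinj : Function.Injective θ₀ := fun w₁ w₂ h => by
    have h' := congrArg (fun z : integralClosure D' (FractionRing D') => (z : FractionRing D')) h
    simp only [hθ₀] at h'
    exact Subtype.ext (ψ₀.injective h')
  have hθsurj : Function.Surjective θ₀ := fun w' => by
    refine ⟨⟨ψ.symm w', hbwd w' w'.2⟩, Subtype.ext ?_⟩
    rw [hθ₀]
    change ψ₀ (ψ.symm w') = w'
    rw [← hψ, RingEquiv.apply_symm_apply]
  refine ⟨RingEquiv.ofBijective θ₀ ⟨hθinj, hθsurj⟩, fun a => Subtype.ext ?_⟩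
  change ψ₀ (algebraMap D (FractionRing D) a) = algebraMap D' (FractionRing D') (φ a)
  exact hψalg a

/-- **SAME NORMALISATION along a ring isomorphism.** -/
theorem exists_integralClosure_ringEquiv_of_ringEquiv (σ : D ≃+* D') :
    ∃ e : integralClosure D (FractionRing D) ≃+* integralClosure D' (FractionRing D'),
      ∀ a : D, e (algebraMap D _ a) = algebraMap D' _ (σ a) :=
  exists_integralClosure_ringEquiv_of_birational (σ : D →+* D') σ.injective
    (fun x => ⟨σ.symm x, 1, one_ne_zero, by simp⟩) (RingHom.isIntegral_of_surjective _ σ.surjective)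

/-- The normalisation of `D` is a discrete valuation ring if that of `D′` is (injective, birational, integral `φ`). -/
theorem isDiscreteValuationRing_integralClosure_of_birational (φ : D →+* D') (hφ : Function.Injective φ)
    (hbir : ∀ x : D', ∃ a b : D, b ≠ 0 ∧ φ b * x = φ a) (hint : φ.IsIntegral)
    (hW' : IsDiscreteValuationRing (integralClosure D' (FractionRing D'))) :
    IsDiscreteValuationRing (integralClosure D (FractionRing D)) := by
  obtain ⟨e, -⟩ := exists_integralClosure_ringEquiv_of_birational φ hφ hbir hint
  exact SigmaMaxModificationsCorridor3.Helpers.isDiscreteValuationRing_of_ringEquiv e.symm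

/-- **SAME VALUATION.**  For an injective birational integral `φ : D → D′` whose normalisations are discrete valuation rings,
`addVal_{W′}(φ a) = addVal_W(a)` for every `a ∈ D`. -/
theorem addVal_integralClosure_eq_of_birational (φ : D →+* D') (hφ : Function.Injective φ)
    (hbir : ∀ x : D', ∃ a b : D, b ≠ 0 ∧ φ b * x = φ a) (hint : φ.IsIntegral)
    (hW : IsDiscreteValuationRing (integralClosure D (FractionRing D)))
    (hW' : IsDiscreteValuationRing (integralClosure D' (FractionRing D'))) (a : D) :
    IsDiscreteValuationRing.addVal (integralClosure D' (FractionRing D')) (algebraMap D' _ (φ a)) =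
      IsDiscreteValuationRing.addVal (integralClosure D (FractionRing D)) (algebraMap D _ a) := by
  obtain ⟨e, he⟩ := exists_integralClosure_ringEquiv_of_birational φ hφ hbir hint
  rw [← he]
  -- a ring isomorphism of discrete valuation rings preserves `addVal` (write `x = u ϖⁿ`)
  generalize algebraMap D (integralClosure D (FractionRing D)) a = x
  by_cases hx : x = 0
  · subst hx; simp
  obtain ⟨ϖ, hϖ⟩ := IsDiscreteValuationRing.exists_irreducible (integralClosure D (FractionRing D))
  obtain ⟨n, u, hxu⟩ := IsDiscreteValuationRing.eq_unit_mul_pow_irreducible hx hϖ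
  rw [IsDiscreteValuationRing.addVal_def x u hϖ n hxu, IsDiscreteValuationRing.addVal_def (e x) (Units.map e.toMonoidHom u)
    ((MulEquiv.irreducible_iff e.toMulEquiv).mpr hϖ) n (by rw [hxu, map_mul, map_pow]; rfl)]

/-- **SAME VALUATION along a ring isomorphism.** -/
theorem addVal_integralClosure_eq_of_ringEquiv (σ : D ≃+* D')
    (hW : IsDiscreteValuationRing (integralClosure D (FractionRing D)))
    (hW' : IsDiscreteValuationRing (integralClosure D' (FractionRing D'))) (a : D) :
    IsDiscreteValuationRing.addVal (integralClosure D' (FractionRing D')) (algebraMap D' _ (σ a)) =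
      IsDiscreteValuationRing.addVal (integralClosure D (FractionRing D)) (algebraMap D _ a) :=
  addVal_integralClosure_eq_of_birational (σ : D →+* D') σ.injective (fun x => ⟨σ.symm x, 1, one_ne_zero, by simp⟩)
    (RingHom.isIntegral_of_surjective _ σ.surjective) hW hW' a

/-- Along a ring isomorphism the two normalisations are discrete valuation rings simultaneously. -/
theorem isDiscreteValuationRing_integralClosure_iff_of_ringEquiv (σ : D ≃+* D') :
    IsDiscreteValuationRing (integralClosure D (FractionRing D)) ↔
      IsDiscreteValuationRing (integralClosure D' (FractionRing D')) := by
  obtain ⟨e, -⟩ := exists_integralClosure_ringEquiv_of_ringEquiv σ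
  exact ⟨fun h => SigmaMaxModificationsCorridor3.Helpers.isDiscreteValuationRing_of_ringEquiv e,
    fun h => SigmaMaxModificationsCorridor3.Helpers.isDiscreteValuationRing_of_ringEquiv e.symm⟩

end Abstract

/-! ## §2 Chart endomorphisms of `k⟦X₀,X₁,X₂⟧`: the quotient map is injective, finite and birational -/

section PowerSeries

variable {k : Type} [Field k]

/-- In dimension one every prime strictly above `P` is the maximal ideal. -/
theorem eq_maximalIdeal_of_lt {P Q : Ideal (MvPowerSeries (Fin 3) k)} [P.IsPrime] [Q.IsPrime]
    (hdim : ringKrullDim (MvPowerSeries (Fin 3) k ⧸ P) = 1) (hPQ : P < Q) :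
    Q = maximalIdeal (MvPowerSeries (Fin 3) k) := by
  rw [ringKrullDim_quotient] at hdim
  rcases Order.krullDim_le_one_iff.mp hdim.le ⟨⟨Q, ‹_›⟩, hPQ.le⟩ with hmin | hmax
  · exfalso
    have h : (⟨⟨P, ‹_›⟩, le_refl P⟩ : PrimeSpectrum.zeroLocus (R := MvPowerSeries (Fin 3) k) (P : Set _)) ≤ ⟨⟨Q, ‹_›⟩, hPQ.le⟩ :=
      hPQ.le
    have h' := hmin h
    exact absurd (le_antisymm hPQ.le h') (ne_of_lt hPQ)
  · have hQm : Q ≤ maximalIdeal _ := IsLocalRing.le_maximalIdeal (Ideal.IsPrime.ne_top ‹_›)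
    have h : (⟨⟨Q, ‹_›⟩, hPQ.le⟩ : PrimeSpectrum.zeroLocus (R := MvPowerSeries (Fin 3) k) (P : Set _)) ≤
        ⟨⟨maximalIdeal _, inferInstance⟩, hPQ.le.trans hQm⟩ := hQm
    exact le_antisymm hQm (hmax h)

/-- **Jets modulo a curve branch**: if `dim R₃ ⧸ P = 1` and `v ∉ P` then `𝔪^N ⊆ P + (v)` for some `N`. -/
theorem exists_maximalIdeal_pow_le_sup_span {P : Ideal (MvPowerSeries (Fin 3) k)} [P.IsPrime]
    (hdim : ringKrullDim (MvPowerSeries (Fin 3) k ⧸ P) = 1) {v : MvPowerSeries (Fin 3) k} (hv : v ∉ P) :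
    ∃ N : ℕ, maximalIdeal (MvPowerSeries (Fin 3) k) ^ N ≤ P ⊔ Ideal.span {v} := by
  haveI : IsNoetherianRing (MvPowerSeries (Fin 3) k) := Literature.AlgebraicGeometry.Resolution.isNoetherianRing_mvPowerSeries k (Fin 3)
  refine Ideal.exists_pow_le_of_le_radical_of_fg ?_ (IsNoetherian.noetherian _)
  intro x hx
  rw [Ideal.radical_eq_sInf, Submodule.mem_sInf]
  rintro Q ⟨hJQ, hQ⟩
  haveI := hQ
  have hPQ : P < Q := lt_of_le_of_ne (le_sup_left.trans hJQ)
    (fun h => hv (h ▸ hJQ (Ideal.mem_sup_right (Ideal.mem_span_singleton_self v))))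
  rw [eq_maximalIdeal_of_lt hdim hPQ]
  exact hx

/-- A `k`-algebra endomorphism of `R₃` fixes constants. -/
theorem algHom_C' (c : MvPowerSeries (Fin 3) k →ₐ[k] MvPowerSeries (Fin 3) k) (a : k) : c (C a) = C a :=
  Literature.RingTheory.MvPowerSeries.Jets.algHom_C c a

/-- The comap of a prime along `c` misses `u` when `c u ∉ P′`; in particular it is not the maximal ideal if `u ∈ 𝔪`. -/
theorem comap_ne_maximalIdeal (c : MvPowerSeries (Fin 3) k →ₐ[k] MvPowerSeries (Fin 3) k) (P' : Ideal (MvPowerSeries (Fin 3) k))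
    {u : MvPowerSeries (Fin 3) k} (huM : u ∈ maximalIdeal (MvPowerSeries (Fin 3) k)) (hu : c u ∉ P') :
    P'.comap c ≠ maximalIdeal (MvPowerSeries (Fin 3) k) := fun h =>
  hu (by have := h ▸ huM; exact this)

/-- **`P′ + Φ(𝔪)R₃` is `𝔪`-primary** as soon as `dim R₃ ⧸ P′ = 1` and some `u ∈ 𝔪` has `c u ∉ P′` (the hypothesis `hprim` of
`quotientMap_finite_birational` / `branchVal_comap_eq` for the chart maps, whose exceptional variable is such a `u`). -/
theorem exists_maximalIdeal_pow_le_sup_map (c : MvPowerSeries (Fin 3) k →ₐ[k] MvPowerSeries (Fin 3) k) (P' : Ideal (MvPowerSeries (Fin 3) k)) [P'.IsPrime]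
    (hdim : ringKrullDim (MvPowerSeries (Fin 3) k ⧸ P') = 1) {u : MvPowerSeries (Fin 3) k} (huM : u ∈ maximalIdeal (MvPowerSeries (Fin 3) k)) (hu : c u ∉ P') :
    ∃ N : ℕ, maximalIdeal (MvPowerSeries (Fin 3) k) ^ N ≤ P' ⊔ (maximalIdeal (MvPowerSeries (Fin 3) k)).map c := by
  obtain ⟨N, hN⟩ := exists_maximalIdeal_pow_le_sup_span hdim hu
  refine ⟨N, hN.trans (sup_le_sup_left ?_ _)⟩
  rw [Ideal.span_le, Set.singleton_subset_iff]
  exact Ideal.mem_map_of_mem c huM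

/-- **THE QUOTIENT MAP ALONG A CHART ENDOMORPHISM IS FINITE AND BIRATIONAL.**  Let `c` be a `k`-algebra endomorphism of `R₃ = k⟦X₀,X₁,X₂⟧` and
`P′` a prime with `P′ + c(𝔪)R₃ ⊇ 𝔪^N` (`hprim`) such that every variable is a fraction modulo `P′`: `c g ≡ c t · X i (mod P′)` with `c t ∉ P′`
(`hbir`).  Then the induced injection `φ : R₃ ⧸ comap c P′ → R₃ ⧸ P′` is integral (indeed module-finite: complete Nakayama, Matsumura 8.4, over the
jets) and birational. -/
theorem quotientMap_finite_birational (c : MvPowerSeries (Fin 3) k →ₐ[k] MvPowerSeries (Fin 3) k)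
    (P' : Ideal (MvPowerSeries (Fin 3) k)) [P'.IsPrime]
    (hprim : ∃ N : ℕ, maximalIdeal (MvPowerSeries (Fin 3) k) ^ N ≤ P' ⊔ (maximalIdeal (MvPowerSeries (Fin 3) k)).map c)
    (hbir : ∀ i : Fin 3, ∃ g t : MvPowerSeries (Fin 3) k, c t ∉ P' ∧ c g - c t * X i ∈ P') :
    (Ideal.quotientMap P' (c : MvPowerSeries (Fin 3) k →+* MvPowerSeries (Fin 3) k) le_rfl).IsIntegral ∧
    ∀ x : MvPowerSeries (Fin 3) k ⧸ P', ∃ a b : MvPowerSeries (Fin 3) k ⧸ P'.comap (c : MvPowerSeries (Fin 3) k →+* MvPowerSeries (Fin 3) k),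
      b ≠ 0 ∧ Ideal.quotientMap P' (c : MvPowerSeries (Fin 3) k →+* MvPowerSeries (Fin 3) k) le_rfl b * x =
        Ideal.quotientMap P' (c : MvPowerSeries (Fin 3) k →+* MvPowerSeries (Fin 3) k) le_rfl a := by
  classical
  -- notation
  set P : Ideal (MvPowerSeries (Fin 3) k) := P'.comap (c : MvPowerSeries (Fin 3) k →+* MvPowerSeries (Fin 3) k) with hPdef
  haveI hPpr : P.IsPrime := Ideal.comap_isPrime _ _
  set φ : MvPowerSeries (Fin 3) k ⧸ P →+* MvPowerSeries (Fin 3) k ⧸ P' := Ideal.quotientMap P' (c : MvPowerSeries (Fin 3) k →+* MvPowerSeries (Fin 3) k) le_rfl with hφdef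
  have hφmk : ∀ f : MvPowerSeries (Fin 3) k, φ (Ideal.Quotient.mk P f) = Ideal.Quotient.mk P' (c f) := fun f => Ideal.quotientMap_mk
  haveI : IsNoetherianRing (MvPowerSeries (Fin 3) k) := Literature.AlgebraicGeometry.Resolution.isNoetherianRing_mvPowerSeries k (Fin 3)
  haveI : IsLocalRing (MvPowerSeries (Fin 3) k ⧸ P) := isLocalRing_quotient P
  haveI : IsLocalRing (MvPowerSeries (Fin 3) k ⧸ P') := isLocalRing_quotient P'
  haveI : IsAdicComplete (maximalIdeal (MvPowerSeries (Fin 3) k ⧸ P)) (MvPowerSeries (Fin 3) k ⧸ P) := isAdicComplete_quotient P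
  haveI : IsAdicComplete (maximalIdeal (MvPowerSeries (Fin 3) k ⧸ P')) (MvPowerSeries (Fin 3) k ⧸ P') := isAdicComplete_quotient P'
  haveI : IsNoetherianRing (MvPowerSeries (Fin 3) k ⧸ P') := isNoetherianRing_quotient P'
  letI : Algebra (MvPowerSeries (Fin 3) k ⧸ P) (MvPowerSeries (Fin 3) k ⧸ P') := φ.toAlgebra
  have halg : ∀ d : MvPowerSeries (Fin 3) k ⧸ P, algebraMap (MvPowerSeries (Fin 3) k ⧸ P) (MvPowerSeries (Fin 3) k ⧸ P') d = φ d := fun _ => rfl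
  -- `𝔪_D · D′ = (c(𝔪) R₃) mod P′`
  have hmapeq : (maximalIdeal (MvPowerSeries (Fin 3) k ⧸ P)).map (algebraMap (MvPowerSeries (Fin 3) k ⧸ P) (MvPowerSeries (Fin 3) k ⧸ P')) =
      ((maximalIdeal (MvPowerSeries (Fin 3) k)).map c).map (Ideal.Quotient.mk P') := by
    rw [← IsLocalRing.map_maximalIdeal_of_surjective (Ideal.Quotient.mk P) Ideal.Quotient.mk_surjective, Ideal.map_map]
    have hcm : (algebraMap (MvPowerSeries (Fin 3) k ⧸ P) (MvPowerSeries (Fin 3) k ⧸ P')).comp (Ideal.Quotient.mk P) = (Ideal.Quotient.mk P').comp (c : MvPowerSeries (Fin 3) k →+* MvPowerSeries (Fin 3) k) := by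
      rw [RingHom.algebraMap_toAlgebra]; exact Ideal.quotientMap_comp_mk le_rfl
    show _ = Ideal.map (Ideal.Quotient.mk P') (Ideal.map (c : MvPowerSeries (Fin 3) k →+* MvPowerSeries (Fin 3) k) (maximalIdeal (MvPowerSeries (Fin 3) k)))
    rw [Ideal.map_map, hcm]
  -- the fraction property and its closure properties
  let F : (MvPowerSeries (Fin 3) k ⧸ P') → Prop := fun x => ∃ a b : MvPowerSeries (Fin 3) k ⧸ P, b ≠ 0 ∧ φ b * x = φ a
  have F_zero : F 0 := ⟨0, 1, one_ne_zero, by simp⟩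
  have F_add : ∀ x y, F x → F y → F (x + y) := by
    rintro x y ⟨a, b, hb, hab⟩ ⟨a', b', hb', hab'⟩
    refine ⟨a * b' + a' * b, b * b', mul_ne_zero hb hb', ?_⟩
    rw [map_mul, map_add, map_mul, map_mul, mul_add, ← hab, ← hab']
    ring
  have F_mul : ∀ x y, F x → F y → F (x * y) := by
    rintro x y ⟨a, b, hb, hab⟩ ⟨a', b', hb', hab'⟩
    refine ⟨a * a', b * b', mul_ne_zero hb hb', ?_⟩
    rw [map_mul, map_mul, ← hab, ← hab']
    ring
  have F_smul : ∀ (d : MvPowerSeries (Fin 3) k ⧸ P) (x), F x → F (d • x) := by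
    rintro d x ⟨a, b, hb, hab⟩
    refine ⟨d * a, b, hb, ?_⟩
    rw [Algebra.smul_def, halg, map_mul, ← hab]
    ring
  have F_img : ∀ f : MvPowerSeries (Fin 3) k, F (Ideal.Quotient.mk P' (c f)) := fun f =>
    ⟨Ideal.Quotient.mk P f, 1, one_ne_zero, by rw [map_one, one_mul, hφmk]⟩
  have F_C : ∀ a : k, F (Ideal.Quotient.mk P' (C a)) := fun a => by
    have := F_img (C a); rwa [algHom_C'] at this
  have F_X : ∀ i : Fin 3, F (Ideal.Quotient.mk P' (X i)) := fun i => by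
    obtain ⟨g, t, ht, hgt⟩ := hbir i
    refine ⟨Ideal.Quotient.mk P g, Ideal.Quotient.mk P t, ?_, ?_⟩
    · rw [Ne, Ideal.Quotient.eq_zero_iff_mem, hPdef, Ideal.mem_comap]
      exact ht
    · rw [hφmk, hφmk, ← map_mul, eq_comm, Ideal.Quotient.eq]
      exact hgt
  have F_poly : ∀ q : MvPolynomial (Fin 3) k, F (Ideal.Quotient.mk P' (q : MvPowerSeries (Fin 3) k)) := fun q => by
    induction q using MvPolynomial.induction_on with
    | C a => rw [MvPolynomial.coe_C]; exact F_C a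
    | add p q hp hq => rw [MvPolynomial.coe_add, map_add]; exact F_add _ _ hp hq
    | mul_X p i hp => rw [MvPolynomial.coe_mul, MvPolynomial.coe_X, map_mul]; exact F_mul _ _ hp (F_X i)
  -- the jets: `𝔪^N ⊆ P′ + c(𝔪) R₃`
  obtain ⟨N, hN⟩ := hprim
  -- generators: the monomials of degree `< N`
  let T : Finset (MvPowerSeries (Fin 3) k ⧸ P') :=
    (Finsupp.finite_of_degree_lt (σ := Fin 3) N).toFinset.image fun e => Ideal.Quotient.mk P' ((MvPolynomial.monomial e (1 : k) : MvPolynomial (Fin 3) k) : MvPowerSeries (Fin 3) k)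
  -- the classes of `𝔪^N` lie in `𝔪_D D′`
  have hpowN : ∀ r : MvPowerSeries (Fin 3) k, r ∈ maximalIdeal (MvPowerSeries (Fin 3) k) ^ N →
      Ideal.Quotient.mk P' r ∈ ((maximalIdeal (MvPowerSeries (Fin 3) k ⧸ P)) • (⊤ : Submodule (MvPowerSeries (Fin 3) k ⧸ P) (MvPowerSeries (Fin 3) k ⧸ P'))) := by
    intro r hr
    rw [Ideal.smul_top_eq_map, Submodule.restrictScalars_mem, hmapeq]
    obtain ⟨p', hp', w, hw, rfl⟩ := Submodule.mem_sup.mp (hN hr)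
    rw [map_add, Ideal.Quotient.eq_zero_iff_mem.mpr hp', zero_add]
    exact Ideal.mem_map_of_mem _ hw
  -- `D′ = Σ D·t + 𝔪_D D′`
  have hsup : Submodule.span (MvPowerSeries (Fin 3) k ⧸ P) (T : Set (MvPowerSeries (Fin 3) k ⧸ P')) ⊔ ((maximalIdeal (MvPowerSeries (Fin 3) k ⧸ P)) • (⊤ : Submodule (MvPowerSeries (Fin 3) k ⧸ P) (MvPowerSeries (Fin 3) k ⧸ P'))) = ⊤ := by
    refine Submodule.eq_top_iff'.mpr fun x => ?_
    obtain ⟨f, rfl⟩ := Ideal.Quotient.mk_surjective x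
    have hsplit : f = ((truncTotal N f : MvPolynomial (Fin 3) k) : MvPowerSeries (Fin 3) k) + (f - (truncTotal N f : MvPolynomial (Fin 3) k)) := by ring
    rw [hsplit, map_add]
    refine Submodule.add_mem_sup ?_ (hpowN _ (Literature.RingTheory.MvPowerSeries.Jets.sub_coe_truncTotal_mem_maximalIdeal_pow N f))
    rw [(truncTotal N f).as_sum, ← MvPolynomial.coeToMvPowerSeries.ringHom_apply, map_sum, map_sum]
    refine Submodule.sum_mem _ fun e he => ?_
    have hedeg : e.degree < N := by
      by_contra hN'
      simp only [not_lt] at hN'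
      exact (MvPolynomial.mem_support_iff.1 he) (coeff_truncTotal_eq_zero _ hN')
    have hmono : MvPolynomial.monomial e ((truncTotal N f).coeff e) =
        MvPolynomial.C ((truncTotal N f).coeff e) * MvPolynomial.monomial e (1 : k) := by
      rw [MvPolynomial.C_mul_monomial, mul_one]
    rw [MvPolynomial.coeToMvPowerSeries.ringHom_apply, hmono, MvPolynomial.coe_mul, MvPolynomial.coe_C, map_mul,
      ← algHom_C' c, ← hφmk, ← halg, ← Algebra.smul_def]
    refine Submodule.smul_mem _ _ (Submodule.subset_span ?_)
    rw [Finset.mem_coe]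
    exact Finset.mem_image.mpr ⟨e, by simpa using hedeg, rfl⟩
  -- complete Nakayama (Matsumura 8.4): separatedness of `D′` for the `𝔪_D`-adic topology
  have hloc : (maximalIdeal (MvPowerSeries (Fin 3) k ⧸ P)).map (algebraMap (MvPowerSeries (Fin 3) k ⧸ P) (MvPowerSeries (Fin 3) k ⧸ P')) ≤ maximalIdeal (MvPowerSeries (Fin 3) k ⧸ P') := by
    rw [hmapeq, ← IsLocalRing.map_maximalIdeal_of_surjective (Ideal.Quotient.mk P') Ideal.Quotient.mk_surjective]
    refine Ideal.map_mono ?_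
    rw [Ideal.map_le_iff_le_comap]
    intro g hg
    exact Literature.RingTheory.MvPowerSeries.Jets.algHom_apply_mem_maximalIdeal c hg
  haveI : IsHausdorff (maximalIdeal (MvPowerSeries (Fin 3) k ⧸ P)) (MvPowerSeries (Fin 3) k ⧸ P') := by
    refine ⟨fun x hx => IsHausdorff.haus ‹IsAdicComplete (maximalIdeal (MvPowerSeries (Fin 3) k ⧸ P')) (MvPowerSeries (Fin 3) k ⧸ P')›.toIsHausdorff x fun n => ?_⟩
    have hxn := hx n
    rw [SModEq.zero] at hxn ⊢
    rw [Ideal.smul_top_eq_map, Submodule.restrictScalars_mem, Ideal.map_pow] at hxn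
    rw [smul_eq_mul, Ideal.mul_top]
    exact Ideal.pow_right_mono hloc n hxn
  have htop := Literature.AlgebraicGeometry.Resolution.Matsumura1987_8_4_finset (maximalIdeal (MvPowerSeries (Fin 3) k ⧸ P)) T hsup
  haveI : Module.Finite (MvPowerSeries (Fin 3) k ⧸ P) (MvPowerSeries (Fin 3) k ⧸ P') := ⟨⟨T, htop⟩⟩
  refine ⟨fun x => Algebra.IsIntegral.isIntegral (R := MvPowerSeries (Fin 3) k ⧸ P) x, fun x => ?_⟩
  -- birationality: the fractions form a submodule containing the generators
  let S : Submodule (MvPowerSeries (Fin 3) k ⧸ P) (MvPowerSeries (Fin 3) k ⧸ P') :=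
    { carrier := {x | F x}
      zero_mem' := F_zero
      add_mem' := fun {x y} hx hy => F_add x y hx hy
      smul_mem' := fun d {x} hx => F_smul d x hx }
  have hTS : (T : Set (MvPowerSeries (Fin 3) k ⧸ P')) ⊆ S := fun t ht => by
    rw [Finset.mem_coe] at ht
    obtain ⟨e, -, rfl⟩ := Finset.mem_image.mp ht
    exact F_poly _
  have hxS : x ∈ S := (Submodule.span_le.mpr hTS) (by rw [htop]; exact Submodule.mem_top)
  exact hxS

/-- **The comap of a dimension-one prime along a chart endomorphism has dimension one** (integral injective extension: Matsumura 9.4). -/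
theorem ringKrullDim_quotient_comap_eq_one (c : MvPowerSeries (Fin 3) k →ₐ[k] MvPowerSeries (Fin 3) k)
    (P' : Ideal (MvPowerSeries (Fin 3) k)) [P'.IsPrime] (hdim : ringKrullDim (MvPowerSeries (Fin 3) k ⧸ P') = 1)
    (hprim : ∃ N : ℕ, maximalIdeal (MvPowerSeries (Fin 3) k) ^ N ≤ P' ⊔ (maximalIdeal (MvPowerSeries (Fin 3) k)).map c)
    (hbir : ∀ i : Fin 3, ∃ g t : MvPowerSeries (Fin 3) k, c t ∉ P' ∧ c g - c t * X i ∈ P') :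
    ringKrullDim (MvPowerSeries (Fin 3) k ⧸ P'.comap c) = 1 := by
  obtain ⟨hint, -⟩ := quotientMap_finite_birational c P' hprim hbir
  letI : Algebra (MvPowerSeries (Fin 3) k ⧸ P'.comap (c : MvPowerSeries (Fin 3) k →+* MvPowerSeries (Fin 3) k)) (MvPowerSeries (Fin 3) k ⧸ P') :=
    (Ideal.quotientMap P' (c : MvPowerSeries (Fin 3) k →+* MvPowerSeries (Fin 3) k) le_rfl).toAlgebra
  haveI : Algebra.IsIntegral (MvPowerSeries (Fin 3) k ⧸ P'.comap (c : MvPowerSeries (Fin 3) k →+* MvPowerSeries (Fin 3) k)) (MvPowerSeries (Fin 3) k ⧸ P') := ⟨hint⟩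
  show ringKrullDim (MvPowerSeries (Fin 3) k ⧸ P'.comap (c : MvPowerSeries (Fin 3) k →+* MvPowerSeries (Fin 3) k)) = 1
  rw [← hdim]
  exact Literature.RingTheory.KrullDimension.ringKrullDim_eq_of_isIntegral Ideal.quotientMap_injective

end PowerSeries

end TOT2Branch

end Summit.ResolutionOfSingularities.ResolutionOfSingularities.Theorems

end
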